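import Literature.AlgebraicGeometry.Motives.Cycles
import HarnessLib

/-!
# Discharged fact: principal divisors have locally finite support (Stacks 02RL)

`Literature.AlgebraicGeometry.Motives.Cycles` records as a named fact
(`Literature.ClosedSubvariety.locallyFiniteSupport_divFun : Prop`) that for a closed subvariety
`W ↪ X` (an integral scheme with a closed immersion `ι : W ⟶ X`), `W` locally Noetherian, and
`f ∈ K(W)`, the coefficient function `W.divFun f : X → ℤ` of the principal divisor `div f`
(Mathlib's order of vanishing `Scheme.ord f` on `W`, extended by zero along `ι`) has locally
finite support. This file proves it.

The source is Stacks Project, Divisors, Lemma 02RL: for a locally Noetherian integral scheme `X`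
and `f ∈ R(X)^*`, the prime divisors `Z` with `ord_Z(f) ≠ 0` form a locally finite collection.
The printed proof: `f` is a unit section over some nonempty open `U`, so every such `Z` is an
irreducible component of `X \ U`, and the irreducible components of a closed subscheme of a
locally Noetherian scheme are locally finite (Lemma 0BE1: a quasi-compact open is a Noetherian
topological space). We follow it, with Mathlib's `exists_isUnit_germ_eq` and
`Scheme.ord_of_isUnit` providing `U`, and with Lemma 0BE1 used in its algebraic form on an
affine open neighbourhood `Spec A` (`A = Γ(X, V)` a Noetherian domain): a codimension-one point
of `X \ U` inside `Spec A` is a height-one prime (`idealHeight_eq_coheight`) containing the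
nonzero ideal `I` of `(X \ U) ∩ Spec A`, hence a minimal prime of `I`, and `I` has finitely many
minimal primes (`Ideal.finite_minimalPrimes_of_isNoetherianRing`). The passage from `W` to `X`
only uses that `ι` is a closed topological embedding.

## Main results

* `Literature.AlgebraicGeometry.Motives.mem_minimalPrimes_of_height_eq_one`: in a domain, a height-one prime containing a nonzero
  ideal `I` is a minimal prime of `I`.
* `Literature.AlgebraicGeometry.Motives.exists_nhds_finite_inter_coheight_eq_one`: Stacks 0BE1 in codimension one — the
  codimension-one points of a closed subset missing the generic point of a locally Noetherian
  integral scheme are locally finite.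
* `Literature.AlgebraicGeometry.Motives.locallyFiniteSupport_ord`: Stacks 02RL for Mathlib's `Scheme.ord`.
* `Literature.AlgebraicGeometry.Motives.ClosedSubvariety.locallyFiniteSupport_divFun_holds`: the discharge of the named fact.

## References

* [StacksProject] The Stacks Project, Tags 02RL, 0BE1 (Divisors, section "Weil divisors",
  Tag 0BE0).
-/

universe u

open CategoryTheory AlgebraicGeometry Order Topology

namespace Literature.AlgebraicGeometry.Motives

section DivisorLocallyFinite

variable {X : Scheme.{u}}

/-- In a domain, a prime ideal of height one containing a nonzero ideal `I` is a minimal prime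
of `I` (no prime lies strictly between `⊥` and a height-one prime). [folklore] -/
lemma mem_minimalPrimes_of_height_eq_one {A : Type*} [CommRing A] [IsDomain A]
    {I p : _root_.Ideal A} [p.IsPrime] (hI : I ≠ ⊥) (hIp : I ≤ p) (hp : p.height = 1) :
    p ∈ I.minimalPrimes := by
  have : p.FiniteHeight := ⟨Or.inr (by simp [hp])⟩
  refine Ideal.mem_minimalPrimes_of_height_eq hIp ?_
  rw [hp]
  exact Order.one_le_iff_ne_zero.mpr (mt Ideal.height_eq_zero_iff_eq_bot.mp hI)

/-- **Stacks 0BE1**, codimension-one case: on a locally Noetherian integral scheme `X`, the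
codimension-one points lying in a closed subset `Z` missing the generic point form a locally
finite set. Proof on an affine open neighbourhood `Spec A` of `y` (`A = Γ(X, V)` a Noetherian
domain): such points are height-one primes containing the nonzero radical ideal `I` of
`Z ∩ Spec A`, hence minimal primes of `I` (`mem_minimalPrimes_of_height_eq_one`), of which there
are finitely many (`Ideal.finite_minimalPrimes_of_isNoetherianRing`).
[cite: StacksProject, Tag 0BE1] -/
lemma exists_nhds_finite_inter_coheight_eq_one [IsIntegral X] [IsLocallyNoetherian X]
    {Z : Set X} (hZ : IsClosed Z) (hη : genericPoint X ∉ Z) (y : X) :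
    ∃ t ∈ 𝓝 y, (t ∩ {x | x ∈ Z ∧ coheight x = 1}).Finite := by
  obtain ⟨_, ⟨V, hV, rfl⟩, hyV, -⟩ :=
    X.isBasis_affineOpens.exists_subset_of_mem_open (Set.mem_univ y) isOpen_univ
  have hV : IsAffineOpen V := hV
  refine ⟨V, V.isOpen.mem_nhds hyV, ?_⟩
  haveI : Nonempty V := ⟨⟨y, hyV⟩⟩
  haveI : IsNoetherianRing Γ(X, V) := IsLocallyNoetherian.component_noetherian ⟨V, hV⟩
  set g := hV.fromSpec with hg
  set C : Set (Spec Γ(X, V)) := g ⁻¹' Z with hC_def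
  set I := PrimeSpectrum.vanishingIdeal C with hI_def
  have hC : IsClosed C := hZ.preimage g.continuous
  have hCI : PrimeSpectrum.zeroLocus (I : Set Γ(X, V)) = C := by
    rw [hI_def, PrimeSpectrum.zeroLocus_vanishingIdeal_eq_closure]
    exact hC.closure_eq
  -- `I ≠ ⊥`: otherwise the generic point `⊥` of `Spec A`, which `g` sends to the generic
  -- point of `X`, would lie in `C = g ⁻¹' Z`.
  have hI : I ≠ ⊥ := by
    intro hI0
    apply hη
    have hbot : (⊥ : PrimeSpectrum Γ(X, V)) ∈ C := by
      rw [← hCI, hI0]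
      refine (PrimeSpectrum.mem_zeroLocus _ _).mpr ?_
      intro a ha
      rw [SetLike.mem_coe, Ideal.mem_bot] at ha
      rw [ha, SetLike.mem_coe]
      exact zero_mem _
    have h1 := genericPoint_eq_of_isOpenImmersion g
    rw [genericPoint_eq_bot_of_affine] at h1
    rw [← h1]
    exact hbot
  have hfin : {p : Spec Γ(X, V) | p.asIdeal ∈ I.minimalPrimes}.Finite := by
    refine (Ideal.finite_minimalPrimes_of_isNoetherianRing _ I).preimage ?_
    exact fun p _ q _ h => PrimeSpectrum.ext h
  refine (hfin.image g).subset ?_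
  rintro x ⟨hxV, hxZ, hx1⟩
  obtain ⟨p, rfl⟩ : x ∈ Set.range g := by rwa [hg, hV.range_fromSpec]
  refine ⟨p, ?_, rfl⟩
  show p.asIdeal ∈ I.minimalPrimes
  have hp1 : p.asIdeal.height = 1 := by
    rw [idealHeight_eq_coheight, ← coheight_eq_of_isOpenImmersion g]
    exact hx1
  have hIp : I ≤ p.asIdeal := fun a ha => (PrimeSpectrum.mem_vanishingIdeal _ _).mp ha p hxZ
  exact mem_minimalPrimes_of_height_eq_one hI hIp hp1

/-- **Stacks 02RL** for Mathlib's order of vanishing `Scheme.ord`: on a locally Noetherian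
integral scheme `X` and for `f ∈ K(X)`, the function `x ↦ ord f x` has locally finite support
(for `f = 0` the support is empty by the junk value `Scheme.ord_zero`). Proof as printed: `f ≠ 0`
is the germ of a unit section `f'` over a nonempty affine open `U` (`exists_isUnit_germ_eq`), so
`ord f` vanishes on `U` (`Scheme.ord_of_isUnit`) and off the codimension-one points
(`Scheme.ord_eq_zero_of_coheight_neq_one`); conclude by
`exists_nhds_finite_inter_coheight_eq_one` applied to `Z = X \ U`.
[cite: StacksProject, Tag 02RL] -/
theorem locallyFiniteSupport_ord [IsIntegral X] [IsLocallyNoetherian X] (f : X.functionField) :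
    LocallyFiniteSupport (Scheme.ord f) := by
  intro y
  by_cases hf : f = 0
  · subst hf
    exact ⟨Set.univ, Filter.univ_mem, by simp⟩
  obtain ⟨U, hU, f', hne, hf'f, hf'⟩ := exists_isUnit_germ_eq X f hf
  have hη : genericPoint X ∈ (U : Set X) :=
    ((genericPoint_spec X).mem_open_set_iff U.isOpen).mpr (by simpa using hne)
  obtain ⟨t, ht, hfin⟩ := exists_nhds_finite_inter_coheight_eq_one (X := X)
    (Z := (U : Set X)ᶜ) U.isOpen.isClosed_compl (fun h => h hη) y
  refine ⟨t, ht, hfin.subset ?_⟩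
  rintro x ⟨hxt, hx⟩
  refine ⟨hxt, ?_, ?_⟩
  · intro hxU
    apply hx
    rw [← hf'f]
    exact Scheme.ord_of_isUnit hf' hxU
  · by_contra h1
    exact hx (Scheme.ord_eq_zero_of_coheight_neq_one h1 f)

end DivisorLocallyFinite

namespace ClosedSubvariety

variable {X : Scheme.{u}} (W : ClosedSubvariety X)

/-- **Stacks 02RL**, discharging the named fact `ClosedSubvariety.locallyFiniteSupport_divFun`:
the principal divisor `W.divFun f` of `f ∈ K(W)` (Mathlib's `Scheme.ord f` on `W`, extended by
zero along the closed immersion `ι : W ⟶ X`) has locally finite support on `X`. On `W` this is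
`locallyFiniteSupport_ord`; it transfers to `X` because `ι` is a closed topological embedding
(neighbourhoods of `ι w` pull back to neighbourhoods of `w`, and `divFun f` vanishes on the open
complement of the range). [cite: StacksProject, Tag 02RL] -/
theorem locallyFiniteSupport_divFun_holds : W.locallyFiniteSupport_divFun := by
  intro _ f z
  have hW := locallyFiniteSupport_ord (X := W.carrier) f
  by_cases hz : z ∈ Set.range W.ι.base
  · obtain ⟨w, rfl⟩ := hz
    obtain ⟨t, ht, hfin⟩ := hW w
    have hnhds : 𝓝 w = Filter.comap W.ι.base (𝓝 (W.ι.base w)) :=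
      W.ι.isClosedEmbedding.isInducing.nhds_eq_comap w
    rw [hnhds, Filter.mem_comap] at ht
    obtain ⟨s, hs, hst⟩ := ht
    refine ⟨s, hs, (hfin.image W.ι.base).subset ?_⟩
    rintro x ⟨hxs, hx⟩
    by_cases hxr : x ∈ Set.range W.ι.base
    · obtain ⟨w', rfl⟩ := hxr
      refine ⟨w', ⟨hst hxs, ?_⟩, rfl⟩
      rwa [Function.mem_support, ← W.divFun_ι_base f w']
    · exact (hx (W.divFun_of_notMem_range f hxr)).elim
  · refine ⟨(Set.range W.ι.base)ᶜ,
      W.ι.isClosedEmbedding.isClosed_range.isOpen_compl.mem_nhds hz, ?_⟩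
    convert Set.finite_empty
    ext x
    simp only [Set.mem_inter_iff, Set.mem_compl_iff, Function.mem_support, Set.mem_empty_iff_false,
      iff_false, not_and, not_not]
    exact fun hx => W.divFun_of_notMem_range f hx

end ClosedSubvariety

end Literature.AlgebraicGeometry.Motives
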